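import Summits.PneNP.PneNP.Theorems.ExpanderLinearGeneratorsResolutionNFreeColumnLaw
import Literature.Computability.MetaComplexity.ResolutionRestrictionMap
import Summits.PneNP.PneNP.Theorems.ExpanderLinearGeneratorsExpansionForcesDepthFregeSizeEightReduction
import Summits.PneNP.PneNP.Theorems.ExpanderLinearGeneratorsLightExpansion
import Literature.Computability.MetaComplexity.ParityDNF
import HarnessLib

/-!
# The n-free resolution-size rung for expanding linear systems, XIII: the exponential law when the LIGHT variables carry the expansion

Support file for the cruxes `stmt-PneNP-11443`
(`Summit.PneNP.PneNP.Theses.ExpanderLinearGenerators.LinearGeneratorDepthFregeHard`, Krajíček's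
Problem 19.4.5 in universal-expander form) and `stmt-PneNP-11442` (`ExpansionForcesDepthFregeSize`,
the expansion-scale law). File XII (`resolution_size_nfree_column`, THEOREM C) proved the n-free,
m-free EXPONENTIAL resolution-size law for `ℓ`-sparse `(r, 3ℓ/4)`-boundary expanders all of whose
variables have column weight `≤ Δ₀ := r^{(1-ε)ℓ/2-1}/2^ℓ`. Here the column-weight hypothesis is
removed from the HEAVY variables altogether, provided the LIGHT ones (column weight `≤ Δ`) carry
the expansion: if the light parts of the row supports form an `(r, 3ℓ/4)`-boundary expander and
`Δ ≤ Δ₀`, every resolution refutation of `sumEncoding 1 E` has `≥ 2^{r^ε/(128ℓ)-1}` lines, for any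
`n`, any `m` and ARBITRARY heavy variables (`resolution_size_nfree_light`). Proof: substitute `0`
for the heavy variables — a restriction, which maps a refutation of `sumEncoding 1 E` to a
refutation of the XOR-CNF of the column-zeroed system of the same length
(`IsResRefutation.exists_restrict`; the clause-level bookkeeping is
`satisfiedBy_or_restrictClause_mem`, the column-zeroed system is that of
`LinGen.linearGeneratorDepthFregeHard_of_light_expansion`) — and apply Theorem C to the zeroed system, whose supports
are the light parts and whose column weight is `≤ Δ`.

Crux-shaped corollaries (the resolution rung of crux 11443 at every scale `n^{1-δ}`, `δ < 1`, for
light-expanding systems) are in file XIV. (The tree's `ResSim.resolution_size_of_light_expansion`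
is the case "light = column weight ≤ 2", through bounded-depth Frege; the Ben-Sasson–Wigderson rung
`linearGenerator_resolution_size_lower_bound` needs `δ < 1/2`.) What is left open at the resolution
rung is exactly the case where the expansion genuinely needs variables of column weight
`r^{Ω(ℓ)}`.

References: E. Ben-Sasson, A. Wigderson, J. ACM 48 (2001), §2.2 (restrictions of refutations),
Thm. 6.5; P. Beame, T. Pitassi, FOCS 1996; J. Krajíček, *Proof complexity* (CUP 2019), §5.1,
§13.4, Problem 19.4.5; D. Sokolov, *Pseudorandom generators, resolution and heavy width*, CCC 2022
(the `m ≫ n²` barrier of the restriction technique for generator tautologies).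
-/

namespace Summit.PneNP.PneNP.Theorems.ResNFree

set_option linter.dupNamespace false -- `Summit.PneNP.PneNP.…`: summit = sub-problem (D-0017)

open Finset Filter Topology Literature.Computability.Complexity Literature.Computability.MetaComplexity

variable {m n : ℕ}

/-! ### Zeroing columns: the system with the variables outside `L` substituted by `0` -/

section Zero

variable {L : Finset (Fin n)} {E E' : Fin m → LinEqMod 2 n}
  (hE' : ∀ i j, (E' i).1 j = if j ∈ L then (E i).1 j else 0) (hb : ∀ i, (E' i).2 = (E i).2)

include hE'

/-- The Boolean variables of a column-zeroed equation (`B = 1`): those of the equation that are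
kept. [folklore] -/
theorem mem_eqVars_zero_iff (i : Fin m) (v : ℕ) :
    v ∈ eqVars 1 (E' i) ↔ v ∈ eqVars 1 (E i) ∧ ∃ h : v < n, (⟨v, h⟩ : Fin n) ∈ L := by
  rw [mem_eqVars, mem_eqVars]
  constructor
  · rintro ⟨j, hj, hv⟩
    rw [LinGen.supp_restrict hE' i, Finset.mem_filter] at hj
    obtain ⟨k, hk, rfl⟩ := mem_encBlock.1 hv
    have hk0 : k = 0 := by omega
    subst hk0
    refine ⟨⟨j, hj.1, mem_encBlock.2 ⟨0, one_pos, rfl⟩⟩, ⟨by simp [j.2], ?_⟩⟩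
    have : (⟨(j : ℕ) * 1 + 0, by simp [j.2]⟩ : Fin n) = j := Fin.ext (by simp)
    rw [this]; exact hj.2
  · rintro ⟨⟨j, hj, hv⟩, h, hL⟩
    obtain ⟨k, hk, rfl⟩ := mem_encBlock.1 hv
    have hk0 : k = 0 := by omega
    subst hk0
    have : (⟨(j : ℕ) * 1 + 0, h⟩ : Fin n) = j := Fin.ext (by simp)
    rw [this] at hL
    refine ⟨j, ?_, mem_encBlock.2 ⟨0, one_pos, rfl⟩⟩
    rw [LinGen.supp_restrict hE' i, Finset.mem_filter]
    exact ⟨hj, hL⟩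

include hb

/-- **Substituting `0` for the variables outside `L` maps the XOR-CNF of `E` into the XOR-CNF of
the column-zeroed system, clause by clause.** Let `ρ` assign `false` to the variables `< n`
outside `L` and nothing else. Every clause of `sumEncoding 1 E` is either satisfied by `ρ` (it
contains a negative literal on a zeroed variable) or restricts to a clause of `sumEncoding 1 E'`
(its zeroed variables all occur positively, i.e. the forbidden local assignment vanishes outside
`L`, and what is left is the clause of the zeroed row forbidding the same assignment of the kept
variables). [Ben-Sasson–Wigderson 2001, §2.2, §4.2] [folklore] -/
theorem satisfiedBy_or_restrictClause_mem (ρ : ℕ → Option Bool)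
    (hρ : ∀ v, ρ v = if h : v < n then (if (⟨v, h⟩ : Fin n) ∈ L then none else some false)
      else none)
    {C : Finset (Literal ℕ)} (hC : C ∈ (sumEncoding 1 E).clauseFinsets) :
    SatisfiedBy ρ C ∨ restrictClause ρ C ∈ (sumEncoding 1 E').clauseFinsets := by
  classical
  -- `C` is the canonical clause of a violating sublist `S` of the variable list `V` of a row `k`
  simp only [CNF.clauseFinsets, List.mem_map] at hC
  obtain ⟨c, hc, rfl⟩ := hC
  simp only [sumEncoding, List.mem_flatMap, List.mem_finRange, true_and] at hc
  obtain ⟨k, hck⟩ := hc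
  have hck' := hck
  rw [equationCNF, canonicalCNF] at hck'
  simp only [List.mem_map, List.mem_filter] at hck'
  obtain ⟨S, ⟨hSsub, hSP⟩, rfl⟩ := hck'
  rw [List.mem_sublists] at hSsub
  set V := eqVars 1 (E k) with hV
  have hρV : ∀ v ∈ V, ρ v = none ∨ ρ v = some false := by
    intro v _
    rw [hρ v]
    split_ifs <;> simp
  by_cases hheavy : ∃ v ∈ S, ρ v = some false
  · -- a zeroed variable in `S`: its literal `(v, false)` is in the clause and `ρ` makes it true
    left
    obtain ⟨v, hvS, hρv⟩ := hheavy
    refine ⟨(v, false), ?_, by simpa using hρv⟩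
    rw [List.mem_toFinset, List.mem_map]
    exact ⟨v, hSsub.subset hvS, by simp [hvS]⟩
  · right
    push Not at hheavy
    have hSnone : ∀ v ∈ S, ρ v = none := fun v hv =>
      (hρV v (hSsub.subset hv)).resolve_right (hheavy v hv)
    set V' := eqVars 1 (E' k) with hV'
    set S' := V'.filter fun v => decide (v ∈ S) with hS'
    have hmemV' : ∀ v, v ∈ V' ↔ v ∈ V ∧ ρ v = none := by
      intro v
      rw [hV', mem_eqVars_zero_iff hE' k v, hρ v]
      constructor
      · rintro ⟨hv, h, hL⟩
        exact ⟨hv, by rw [dif_pos h, if_pos hL]⟩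
      · rintro ⟨hv, h⟩
        have hvn : v < n := lt_of_mem_eqVars_one hv
        rw [dif_pos hvn] at h
        refine ⟨hv, hvn, ?_⟩
        by_contra hL
        rw [if_neg hL] at h
        exact absurd h (by simp)
    have hS'mem : ∀ v, v ∈ S' ↔ v ∈ V' ∧ v ∈ S := by
      intro v; simp [hS']
    have hdec : ∀ v ∈ V', decide (v ∉ S') = decide (v ∉ S) := by
      intro v hv'
      simp only [hS'mem, hv', true_and]
    -- the restricted clause is the canonical clause of `S'` over `V'`
    have heq : restrictClause ρ (V.map fun v => (v, decide (v ∉ S))).toFinset =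
        (V'.map fun v => (v, decide (v ∉ S'))).toFinset := by
      ext l
      simp only [mem_restrictClause, List.mem_toFinset, List.mem_map]
      constructor
      · rintro ⟨⟨v, hv, rfl⟩, hρv⟩
        have hv' : v ∈ V' := (hmemV' v).2 ⟨hv, hρv⟩
        exact ⟨v, hv', by rw [hdec v hv']⟩
      · rintro ⟨v, hv', rfl⟩
        obtain ⟨hv, hρv⟩ := (hmemV' v).1 hv'
        exact ⟨⟨v, hv, by rw [hdec v hv']⟩, hρv⟩
    rw [heq]
    simp only [CNF.clauseFinsets, List.mem_map]
    refine ⟨V'.map fun v => (v, decide (v ∉ S')), ?_, rfl⟩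
    simp only [sumEncoding, List.mem_flatMap, List.mem_finRange, true_and]
    refine ⟨k, ?_⟩
    rw [equationCNF, canonicalCNF]
    simp only [List.mem_map, List.mem_filter]
    refine ⟨S', ⟨List.mem_sublists.2 (List.filter_sublist), ?_⟩, rfl⟩
    -- `S'` violates the predicate of the zeroed row: semantic argument with the indicator of `S`
    set σ : ℕ → Bool := fun v => decide (v ∈ S) with hσ
    have hfilt : (V'.filter fun v => σ v) = S' := by rw [hS']
    rw [Bool.not_eq_true']
    by_contra hP
    have hP' : eqPred 1 (E' k) S' = true := by
      cases h : eqPred 1 (E' k) S'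
      · exact absurd h hP
      · rfl
    have hev' : (equationCNF 1 (E' k)).eval σ = true := by
      rw [equationCNF, eval_canonicalCNF (nodup_eqVars 1 (E' k)), hfilt]
      exact hP'
    have hholds' : (E' k).Holds (blockVals 2 1 n σ) := by
      have h := eval_equationCNF 1 (E' k) σ
      rw [hev'] at h
      exact of_decide_eq_true h.symm
    have hfun : (fun x => if h : x < n then (if (⟨x, h⟩ : Fin n) ∈ L then σ x else false)
        else σ x) = σ := by
      funext x
      split_ifs with hx hxL
      · rfl
      · symm
        rw [hσ]
        simp only [decide_eq_false_iff_not]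
        intro hxS
        have h1 := hSnone x hxS
        rw [hρ x, dif_pos hx, if_neg hxL] at h1
        exact absurd h1 (by simp)
      · rfl
    have hholds : (E k).Holds (blockVals 2 1 n σ) := by
      have h := (LinGen.holds_restrict_iff hE' hb σ k).1 hholds'
      rwa [hfun] at h
    have hev : (equationCNF 1 (E k)).eval σ = true := by
      rw [eval_equationCNF]; exact decide_eq_true hholds
    have htrue := (CNF.eval_eq_true_iff _ _).1 hev _ hck
    have hfalse : (V.map fun v => (v, decide (v ∉ S))).any (Literal.eval σ) = false :=
      (any_canonicalClause_eq_false_iff σ).2 fun v _ => by simp [hσ]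
    unfold Clause.eval at htrue
    rw [hfalse] at htrue
    exact Bool.false_ne_true htrue

/-- **A refutation of the XOR-CNF of `E` yields one of the XOR-CNF of the column-zeroed system, of
the same length** (provided the zeroed rows keep nonempty supports, so that the target CNF is
nonempty). [Ben-Sasson–Wigderson 2001, §2.2] [folklore] -/
theorem exists_isResRefutation_zero (hne : ∀ i, (E' i).supp.Nonempty) {π : List (ResLine ℕ)}
    (hπ : IsResRefutation (sumEncoding 1 E) π) :
    ∃ π' : List (ResLine ℕ), IsResRefutation (sumEncoding 1 E') π' ∧ π'.length = π.length := by
  classical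
  by_cases hm : m = 0
  · subst hm
    have hEE : E' = E := funext fun i => Fin.elim0 i
    exact ⟨π, by rw [hEE]; exact hπ, rfl⟩
  · set ρ : ℕ → Option Bool := fun v =>
      if h : v < n then (if (⟨v, h⟩ : Fin n) ∈ L then none else some false) else none with hρdef
    have hρ : ∀ v, ρ v = if h : v < n then (if (⟨v, h⟩ : Fin n) ∈ L then none else some false)
        else none := fun v => rfl
    refine hπ.exists_restrict ρ ?_ fun C hC => satisfiedBy_or_restrictClause_mem hE' hb ρ hρ hC
    set k : Fin m := ⟨0, Nat.pos_of_ne_zero hm⟩ with hk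
    have hlenpos := length_equationCNF_pos (E' k) (hne k)
    intro hnil
    have hmem : ∀ c ∈ equationCNF 1 (E' k), c ∈ sumEncoding 1 E' := fun c hc => by
      simp only [sumEncoding, List.mem_flatMap, List.mem_finRange, true_and]
      exact ⟨k, hc⟩
    obtain ⟨c, hc⟩ := List.exists_mem_of_length_pos hlenpos
    have := hmem c hc
    rw [hnil] at this
    simp at this

end Zero

/-! ### The law -/

/-- **The n-free EXPONENTIAL resolution-size law when the light variables carry the expansion.**
For every locality `ℓ ≥ 1` and `0 < ε < 1`, all real `r ≥ 4`, all `n, m, Δ` and every `ℓ`-sparse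
`E : Fin m → LinEqMod 2 n`: if the LIGHT PARTS of the row supports — the variables of the support
lying in at most `Δ` rows — form an `(r, 3ℓ/4)`-boundary expander and `Δ ≤ r^{(1-ε)ℓ/2-1}/2^ℓ`,
then every resolution refutation of `sumEncoding 1 E` has at least `2^{r^ε/(128 ℓ) - 1}` lines —
independently of `n`, of `m`, and of the heavy variables. (With no heavy variable this is
Theorem C, `resolution_size_nfree_column`.) Proof: substitute `0` for the heavy variables and apply
Theorem C to the zeroed system.
[Ben-Sasson–Wigderson 2001, §2.2, Thm. 6.5; Beame–Pitassi 1996; Krajíček 2019, §13.4] [folklore] -/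
theorem resolution_size_nfree_light (ℓ : ℕ) (hℓ : 1 ≤ ℓ) (ε : ℝ) (hε : 0 < ε) (hε1 : ε < 1)
    (r : ℝ) (hr : 4 ≤ r) (n m Δ : ℕ) (E : Fin m → LinEqMod 2 n)
    (hsparse : ∀ i, (E i).supp.card ≤ ℓ)
    (hexp : IsBoundaryExpander
      (fun i => ((E i).supp.filter fun j =>
        ((univ : Finset (Fin m)).filter fun i' => j ∈ (E i').supp).card ≤ Δ).map Fin.valEmbedding)
      r (3 / 4 * ℓ))
    (hΔ : (Δ : ℝ) ≤ r ^ ((1 - ε) * ℓ / 2 - 1) / 2 ^ ℓ)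
    (π : List (ResLine ℕ)) (hπ : IsResRefutation (sumEncoding 1 E) π) :
    (2 : ℝ) ^ (r ^ ε / (128 * ℓ) - 1) ≤ (π.length : ℝ) := by
  classical
  -- the light variables and the zeroed system
  set L : Finset (Fin n) := univ.filter fun j =>
    ((univ : Finset (Fin m)).filter fun i' => j ∈ (E i').supp).card ≤ Δ with hL
  set E' : Fin m → LinEqMod 2 n := fun i => (fun j => if j ∈ L then (E i).1 j else 0, (E i).2)
    with hE'def
  have hE' : ∀ i j, (E' i).1 j = if j ∈ L then (E i).1 j else 0 := fun i j => rfl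
  have hb : ∀ i, (E' i).2 = (E i).2 := fun i => rfl
  have hsupp : ∀ i, (E' i).supp = (E i).supp.filter fun j =>
      ((univ : Finset (Fin m)).filter fun i' => j ∈ (E i').supp).card ≤ Δ := by
    intro i
    rw [LinGen.supp_restrict hE' i]
    exact Finset.filter_congr fun j _ => by simp [hL]
  have hsparse' : ∀ i, (E' i).supp.card ≤ ℓ := fun i => by
    rw [hsupp i]; exact (Finset.card_filter_le _ _).trans (hsparse i)
  have hexp' : IsBoundaryExpander (fun i => (E' i).supp.map Fin.valEmbedding) r (3 / 4 * ℓ) := by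
    have : (fun i => (E' i).supp.map Fin.valEmbedding) = fun i => ((E i).supp.filter fun j =>
        ((univ : Finset (Fin m)).filter fun i' => j ∈ (E i').supp).card ≤ Δ).map Fin.valEmbedding :=
      funext fun i => by rw [hsupp i]
    rw [this]
    exact hexp
  have hcol' : ∀ j : Fin n, ((univ : Finset (Fin m)).filter fun i => j ∈ (E' i).supp).card ≤ Δ := by
    intro j
    by_cases hj : ((univ : Finset (Fin m)).filter fun i' => j ∈ (E i').supp).card ≤ Δ
    · refine le_trans (Finset.card_le_card ?_) hj
      intro i hi
      simp only [Finset.mem_filter, Finset.mem_univ, true_and] at hi ⊢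
      rw [hsupp i, Finset.mem_filter] at hi
      exact hi.1
    · have h0 : ((univ : Finset (Fin m)).filter fun i => j ∈ (E' i).supp) = ∅ := by
        refine Finset.filter_eq_empty_iff.2 fun i _ hi => ?_
        rw [hsupp i, Finset.mem_filter] at hi
        exact hj hi.2
      rw [h0, Finset.card_empty]
      exact Nat.zero_le _
  -- nonempty zeroed supports (light expansion of single rows), and the transferred refutation
  have hℓpos : (0 : ℝ) < 3 / 4 * ℓ := mul_pos (by norm_num) (Nat.cast_pos.2 hℓ)
  have hne : ∀ i, (E' i).supp.Nonempty := fun i => by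
    have h := hexp'.card_pos hℓpos (by linarith) i
    rw [Finset.card_map] at h
    exact Finset.card_pos.1 h
  obtain ⟨π', hπ', hlen⟩ := exists_isResRefutation_zero hE' hb hne hπ
  have hmain := resolution_size_nfree_column ℓ hℓ ε hε hε1 r hr n m Δ E' hsparse' hexp' hcol' hΔ
    π' hπ'
  rwa [hlen] at hmain

end Summit.PneNP.PneNP.Theorems.ResNFree
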